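import Summits.HubbardSuperconductivity.HubbardSuperconductivity.Theorems.EnslavedA1gGlue
import Summits.HubbardSuperconductivity.HubbardSuperconductivity.Theorems.EnslavedA1gA1gSlavingTransfer
import Summits.HubbardSuperconductivity.HubbardSuperconductivity.Theorems.TwTipContinuation.Negative.TipNormalForm
import Literature.Barriers.HubbardSuperconductivity.PureModelStripeCompetition

/-!
# Route `EnslavedA1g`, crux `BondSingletCondensation` (stmt-HubbardSuperconductivity-0934) — the crux is a
# NECESSARY condition of the summit (crux-strategist r1 census theorem, 2026-08-17)

* `bondSingletCondensation_of_summitShape : (∃ U > 0, ∃ δ ∈ (0,1/2), HasDWavePairFieldLROAt U δ) →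
  BondSingletCondensation` — the hypothesis is `HubbardSuperconductivity` verbatim (`Iff.rfl`); same witness
  `(U,δ)`, bond constant `a = c/2`: the hard half of `summitMatrix_iff_everyGSOrder` (a `Nat.findGreatest`
  diagonal of near-worst ground states turns the summit's per-sequence `liminf > 0` into ONE uniform floor
  `cL⁴ ≤ re⟨Δ_dᴴΔ_d⟩` on every sector ground state at every large even side), then the landed bond
  parallelogram `Δ_{s'}ᴴΔ_{s'} + Δ_dᴴΔ_d = 2(Δ_hᴴΔ_h + Δ_vᴴΔ_v)` (`bondParallelogram_proof`) and `Δ_{s'}ᴴΔ_{s'} ≥ 0`.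
  Pointwise form: `bondDensityFloor_of_hasDWavePairFieldLROAt` (`δ ≥ −1`).
* `bondSingletCondensation_iff_summitShape_of_noOnsiteODLRO : NoOnsiteODLRO → (BondSingletCondensation ↔
  summit shape)` — `→` is the landed Assembly with the landed `a1gSlavingTransfer_proof`, `←` the
  theorem above: modulo the route's other crux the deciding crux IS the summit (strategy census
  `Cruxes/BondSingletCondensation/STRATEGY-CENSUS.md`).

No new definitions; no facts. Sources: D. J. Scalapino, Phys. Rep. 250 (1995) 329, §2 eqs. (2.2)–(2.4)
(pair-field order parameters and the parallelogram of bond channels); S. Friedli, Y. Velenik, *Statistical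
Mechanics of Lattice Systems* (CUP 2017) §3.7.2 (LRO as a liminf); H. Tasaki, *Physics and Mathematics of
Quantum Many-Body Systems* (Springer 2020) §2.1–2.2 (finite-dimensional variational principle).
-/

noncomputable section

-- the mandated namespace repeats `HubbardSuperconductivity` (single-problem summit, D-0017)
set_option linter.dupNamespace false

namespace Summit.HubbardSuperconductivity.HubbardSuperconductivity.Theorems.EnslavedA1g

open Matrix Filter Finset
open Literature.MathematicalPhysics.QuantumLattice Literature.Probability.LatticeModels
open Literature.Barriers.HubbardSuperconductivity (HasDWavePairFieldLROAt)
open Summit.HubbardSuperconductivity.HubbardSuperconductivity.Theses.EnslavedA1g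
open Summit.HubbardSuperconductivity.TwTipContinuation.Negative (everyGSOrder_of_summitMatrix)
open scoped ComplexOrder

/-- `re⟨ψ, Δ_{s'}ᴴΔ_{s'} ψ⟩ = ‖Δ_{s'}ψ‖² ≥ 0`. [folklore] -/
theorem re_expect_extendedSWave_nonneg (L : ℕ) [NeZero L] (ψ : Fock (Orb (FermionTorus 2 L))) :
    0 ≤ (expect ((pairField extendedSWave L)ᴴ * pairField extendedSWave L) ψ).re := by
  rw [PosSemidefTrace.expect_conjTranspose_mul, ← norm_toLp_sq_eq_re]
  positivity

/-- **Parallelogram in expectation**: `re⟨Δ_dᴴΔ_d⟩ = 2(re⟨Δ_hᴴΔ_h⟩ + re⟨Δ_vᴴΔ_v⟩) − re⟨Δ_{s'}ᴴΔ_{s'}⟩`,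
`Δ_h, Δ_v = Δ_{(s' ± d)/2}` (from `bondParallelogram_proof`). Scalapino, Phys. Rep. 250 (1995) 329, §2 eq. (2.2).
[folklore] -/
theorem re_expect_dWave_eq_bond_sub_extendedS (L : ℕ) [NeZero L] (ψ : Fock (Orb (FermionTorus 2 L))) :
    (expect ((pairField dWaveFormFactor L)ᴴ * pairField dWaveFormFactor L) ψ).re =
      2 * ((expect ((pairField (fun e => (extendedSWave e + dWaveFormFactor e) / 2) L)ᴴ *
              pairField (fun e => (extendedSWave e + dWaveFormFactor e) / 2) L) ψ).re +
            (expect ((pairField (fun e => (extendedSWave e - dWaveFormFactor e) / 2) L)ᴴ *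
              pairField (fun e => (extendedSWave e - dWaveFormFactor e) / 2) L) ψ).re) -
        (expect ((pairField extendedSWave L)ᴴ * pairField extendedSWave L) ψ).re := by
  have hpar := congrArg (fun X => (expect X ψ).re) (bondParallelogram_proof L)
  simp only [expect_add, expect_smul, Complex.add_re, Complex.mul_re, Complex.re_ofNat,
    Complex.im_ofNat, zero_mul, sub_zero] at hpar
  linarith

/-- **The `d`-wave pair-field density is at most twice the nearest-neighbour singlet-bond density**:
`re⟨Δ_dᴴΔ_d⟩ ≤ 2(re⟨Δ_hᴴΔ_h⟩ + re⟨Δ_vᴴΔ_v⟩)`. Scalapino, Phys. Rep. 250 (1995) 329, §2. [folklore] -/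
theorem re_expect_dWave_le_two_mul_bond (L : ℕ) [NeZero L] (ψ : Fock (Orb (FermionTorus 2 L))) :
    (expect ((pairField dWaveFormFactor L)ᴴ * pairField dWaveFormFactor L) ψ).re ≤
      2 * ((expect ((pairField (fun e => (extendedSWave e + dWaveFormFactor e) / 2) L)ᴴ *
              pairField (fun e => (extendedSWave e + dWaveFormFactor e) / 2) L) ψ).re +
            (expect ((pairField (fun e => (extendedSWave e - dWaveFormFactor e) / 2) L)ᴴ *
              pairField (fun e => (extendedSWave e - dWaveFormFactor e) / 2) L) ψ).re) := by
  have h1 := re_expect_dWave_eq_bond_sub_extendedS L ψ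
  have h2 := re_expect_extendedSWave_nonneg L ψ
  linarith

/-- **Summit matrix at `(U,δ)` ⇒ uniform bond floor at `(U,δ)`** (`δ ≥ −1`): if every admissible sector-GS
sequence of the pure torus at `(U,δ)` has `d`-wave pair-field LRO (`HasDWavePairFieldLROAt U δ`, word for word
the summit's matrix), then there are `a > 0` and `L₀` such that EVERY normalised `(N_L, S^z = 0)`-sector ground
state at every even side `L ≥ L₀` has nearest-neighbour singlet-bond density `a L⁴ ≤ re⟨Δ_hᴴΔ_h⟩ + re⟨Δ_vᴴΔ_v⟩`
(`a = c/2` from `everyGSOrder_of_summitMatrix` and the parallelogram). Friedli–Velenik 2017 §3.7.2; Scalapino,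
Phys. Rep. 250 (1995) 329, §2. [folklore] -/
theorem bondDensityFloor_of_hasDWavePairFieldLROAt {U δ : ℝ} (hδ : -1 ≤ δ)
    (hS : HasDWavePairFieldLROAt U δ) :
    ∃ a : ℝ, 0 < a ∧ ∃ L₀ : ℕ, ∀ (L : ℕ) [NeZero L], L₀ ≤ L → Even L →
      ∀ ψ : Fock (Orb (FermionTorus 2 L)), star ψ ⬝ᵥ ψ = 1 →
        IsGroundStateInSector (hubbardTorus 2 L 1 U) (2 * ⌊(1 - δ) * (L : ℝ) ^ 2 / 2⌋₊) 0 ψ →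
          a * (L : ℝ) ^ 4 ≤
            (expect ((pairField (fun e => (extendedSWave e + dWaveFormFactor e) / 2) L)ᴴ *
                pairField (fun e => (extendedSWave e + dWaveFormFactor e) / 2) L) ψ).re +
              (expect ((pairField (fun e => (extendedSWave e - dWaveFormFactor e) / 2) L)ᴴ *
                pairField (fun e => (extendedSWave e - dWaveFormFactor e) / 2) L) ψ).re := by
  obtain ⟨c, hc, L₀, hL⟩ := everyGSOrder_of_summitMatrix hδ hS
  refine ⟨c / 2, by positivity, L₀, fun L _ hL₀ hE ψ hu hgs => ?_⟩
  have hfloor := hL L hL₀ hE ψ hu hgs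
  have hpar := re_expect_dWave_le_two_mul_bond L ψ
  linarith

/-- **Summit shape ⇒ `BondSingletCondensation`**: the rank-3 crux of route `EnslavedA1g`
(stmt-HubbardSuperconductivity-0934) is implied by the summit, with the same witness `(U,δ)` and `a = c/2`.
The hypothesis is `HubbardSuperconductivity` VERBATIM (`∃ U > 0, ∃ δ ∈ (0,1/2), HasDWavePairFieldLROAt U δ`
unfolds to `Literature.Hubbard.DWaveSuperconductivityHubbard` by `Iff.rfl`; written in this shape, as in
`TipNormalForm` / `PureModelStripeCompetitionProofs`, so that no summit constant sits in a hypothesis). The crux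
is therefore a NECESSARY condition of the summit: it cannot be refuted without refuting the summit, and every
proof of the summit proves it. (The converse needs exactly the A1g exclusion — see
`bondSingletCondensation_iff_summitShape_of_noOnsiteODLRO`.) Scalapino, Phys. Rep. 250 (1995) 329, §2. [folklore] -/
theorem bondSingletCondensation_of_summitShape :
    (∃ U : ℝ, 0 < U ∧ ∃ δ ∈ Set.Ioo (0 : ℝ) (1 / 2),
        Literature.Barriers.HubbardSuperconductivity.HasDWavePairFieldLROAt U δ) →
      Summit.HubbardSuperconductivity.HubbardSuperconductivity.Theses.EnslavedA1g.BondSingletCondensation := by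
  rintro ⟨U, hU, δ, hδ, hmat⟩
  obtain ⟨a, ha, L₀, hL⟩ :=
    bondDensityFloor_of_hasDWavePairFieldLROAt (U := U) (δ := δ) (by linarith [hδ.1]) hmat
  refine ⟨U, hU, δ, hδ, a, ha, fun N ψ hyp => ⟨L₀, fun L _ hE hL₀ => ?_⟩⟩
  obtain ⟨hN, hu, hgs⟩ := hyp L hE
  rw [hN] at hgs
  have hb := hL L hL₀ hE (ψ L) hu hgs
  have hLpos : (0 : ℝ) < (L : ℝ) := Nat.cast_pos.2 (Nat.pos_of_ne_zero (NeZero.ne L))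
  have hL4 : (0 : ℝ) < (L : ℝ) ^ 4 := by positivity
  rw [le_div_iff₀ hL4]
  linarith

/-- **Modulo the route's other crux, the deciding crux IS the summit**: given `NoOnsiteODLRO`
(stmt-HubbardSuperconductivity-0933), `BondSingletCondensation ↔ (summit shape)` — the right-hand side is
`HubbardSuperconductivity` verbatim (`Iff.rfl`); `→` is the landed Assembly `enslavedA1g_assembly_proof` fed with
the landed `a1gSlavingTransfer_proof` (its conclusion `HubbardSuperconductivity` unfolds definitionally), `←` is
`bondSingletCondensation_of_summitShape`. So the route reads `S ⟺ C ∧ (A1g exclusion at the witness)` with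
`S ⟹ C` outright: `C` is the summit's necessary size half. Zhang, Phys. Rev. Lett. 65 (1990) 120; Scalapino,
Phys. Rep. 250 (1995) 329, §2. [folklore] -/
theorem bondSingletCondensation_iff_summitShape_of_noOnsiteODLRO (hNo : NoOnsiteODLRO) :
    BondSingletCondensation ↔
      ∃ U : ℝ, 0 < U ∧ ∃ δ ∈ Set.Ioo (0 : ℝ) (1 / 2), HasDWavePairFieldLROAt U δ :=
  ⟨fun hB => enslavedA1g_assembly_proof hNo
      Summit.HubbardSuperconductivity.EnslavedA1g.a1gSlavingTransfer_proof hB,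
    bondSingletCondensation_of_summitShape⟩

end Summit.HubbardSuperconductivity.HubbardSuperconductivity.Theorems.EnslavedA1g
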